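import Summits.QuantumFields.YangMills.Theorems.VirialFluxGapRingChartPhase
import Summits.QuantumFields.YangMills.Theorems.VirialFluxGapRingStabilizerRigidity
import HarnessLib

/-!
# Linearising the gauge action in the LEFT exponential chart — one-variable algebra and bookkeeping
# (layer (B2/B3), SLICE-FREE transversality input, of the DIRECT Laplace road to ⟨stmt-QuantumFields-24204⟩ `VirialFluxGap.SharpTwistedLaplace`)

Helper module (free-hands work of width seat ym-line-sfw-p2-w3 g56, cell ym-idea-1; `--supports 24204`).  The coercivity hypothesis
`hcoer` ∕ the quadratic-growth input of ✓`QuantitativeLaplace.coercive_of_quadratic_growth` on a slice through a twist-eater ring needs a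
LOWER bound on the chordal distance `ringDist(h·P, R)` between a gauge transform of a chart point `P = e^{a}·R` and the reference ring `R`,
uniformly over ALL gauge fields `h`, in terms of the part of the chart coordinate `a` transversal to the linearised gauge modes.  This file
is the one-variable algebra behind it (the ring-level statement is ✓`exists_skew_linearised_gauge_le` in `…RingOrbitLinearisation`):

* §1 for unitary `Hx, Hy, R` and `‖A‖ ≤ m ≤ ¼`: with `ξ = ½(H − Hᴴ)` the skew part of `H − 1` (skew-Hermitian, traceless on `SU(2)`;
  the Hermitian part is `−½(H−1)(H−1)ᴴ`, quadratically small), ★ `norm_linearised_link_le`: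
  `‖A + ξx − R ξy Rᴴ‖ ≤ ‖Hx e^{A} R Hyᴴ Rᴴ − 1‖ + 2m² + (3/2)m(εx + εy) + (1 + (3/2)m)εxεy + ½εx² + ½εy²`, `ε• = ‖H• − 1‖`;
* §2 the shifted `ℓ²` bound `√Σu² ≤ √Σf² + √#ι·ρ` from `u ≤ f + ρ` termwise;
* §3 `SU(2)` ∕ ring bookkeeping: a central sign in front of a gauge field is invisible (`gaugeTransform_centreElem_mul`, `centreElem_mul_conj`),
  `‖↑(±u) − 1‖ = fd(u, ±1)`, `fd(U,V) = ‖↑U↑Vᴴ − 1‖`, `2 − Re tr(UV⁻¹) = ½fd²`, `6L³ − timeCoupling = ½Σfd²`, the chart moves a variable by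
  `≤ (3/2)m`, and the arithmetic of the remainder.

Everything here is PROVED; no definitions, no named facts (namespace `Summit.QuantumFields.YangMills.Theorems.VirialFluxGap.ChartPhase`).
HONEST FRAMING: matrix algebra; ⟨24204⟩, ⟨24319⟩ and every rung stay OPEN; the Yang–Mills mass gap (Clay) is NOT touched; no summit is proved
by a line.

## References
* M. Lüscher, Nucl. Phys. B219 (1983), §2 (expansion around the twist-eating flat connections; gauge modes). [Luscher1983]
* A. González-Arroyo, C. P. Korthals Altes, Nucl. Phys. B311 (1988), §2. [GonzalezarroyoAltes1988]
-/

set_option autoImplicit false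

noncomputable section

open scoped Matrix Matrix.Norms.Frobenius BigOperators
open NormedSpace
open Literature.MathematicalPhysics.QuantumFieldTheory hiding SU2
open Literature.MathematicalPhysics.QuantumLattice
open Summit.QuantumFields.YangMills.Theorems.FemtoTransferGap
open Summit.QuantumFields.YangMills.Theorems.FemtoTransferGap.TT
open Summit.QuantumFields.YangMills.Theorems.FemtoTransferGap.TwoLattice
open Summit.QuantumFields.YangMills.Theorems.FemtoTransferGap.TwoLattice.Flat
open Summit.QuantumFields.YangMills.Theorems.FemtoTransferGap.TwoLattice.Cov
open Summit.QuantumFields.YangMills.Theorems.ToronValleyVolume.Lojasiewicz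
open Summit.QuantumFields.YangMills.Theorems.TwistEaterVolume.Quadratic
open Summit.QuantumFields.YangMills.Theorems.VirialFluxGap.RingDeficit
open Summit.QuantumFields.YangMills.Theorems.ColdBoxAllGroups (norm_exp_sub_one_sub_le norm_exp_sub_one_le')

namespace Summit.QuantumFields.YangMills.Theorems.VirialFluxGap.ChartPhase

/-! ## §1 One variable: the linearised gauge action in the left exponential chart -/

/-- For a unitary `H` with `η = H − 1`: the Hermitian part of `η` is quadratically small, `η + ηᴴ = −ηηᴴ`. [folklore] -/
theorem sub_one_add_conjTranspose_eq {H : Matrix (Fin 2) (Fin 2) ℂ} (hH : H ∈ Matrix.unitaryGroup (Fin 2) ℂ) :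
    (H - 1) + (H - 1)ᴴ = -((H - 1) * (H - 1)ᴴ) := by
  have hHH : H * Hᴴ = 1 := by
    simpa only [Matrix.star_eq_conjTranspose] using Matrix.mem_unitaryGroup_iff.mp hH
  rw [Matrix.conjTranspose_sub, Matrix.conjTranspose_one]
  have e : (H - 1) * (Hᴴ - 1) = H * Hᴴ - H - Hᴴ + 1 := by noncomm_ring
  rw [e, hHH]; abel

/-- `‖(H − 1) + (H − 1)ᴴ‖ ≤ ‖H − 1‖²` for unitary `H` (Frobenius). [folklore] -/
theorem norm_sub_one_add_conjTranspose_le {H : Matrix (Fin 2) (Fin 2) ℂ} (hH : H ∈ Matrix.unitaryGroup (Fin 2) ℂ) :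
    ‖(H - 1) + (H - 1)ᴴ‖ ≤ ‖H - 1‖ ^ 2 := by
  rw [sub_one_add_conjTranspose_eq hH, norm_neg]
  calc ‖(H - 1) * (H - 1)ᴴ‖ ≤ ‖H - 1‖ * ‖(H - 1)ᴴ‖ := norm_mul_le _ _
    _ = ‖H - 1‖ ^ 2 := by rw [Matrix.frobenius_norm_conjTranspose, sq]

/-- The skew part `ξ = ½(H − Hᴴ)` of `H − 1` is skew-Hermitian. [folklore] -/
theorem conjTranspose_skewPart (H : Matrix (Fin 2) (Fin 2) ℂ) :
    ((2 : ℝ)⁻¹ • (H - Hᴴ))ᴴ = -((2 : ℝ)⁻¹ • (H - Hᴴ)) := by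
  rw [Matrix.conjTranspose_smul, Matrix.conjTranspose_sub, Matrix.conjTranspose_conjTranspose]
  simp only [star_trivial, ← smul_neg, neg_sub]

/-- The skew part of `H − 1` is traceless for `H ∈ SU(2)` (the trace of an `SU(2)` matrix is real). [folklore] -/
theorem trace_skewPart_su2 (U : SU2) :
    ((2 : ℝ)⁻¹ • ((U : Matrix (Fin 2) (Fin 2) ℂ) - (U : Matrix (Fin 2) (Fin 2) ℂ)ᴴ)).trace = 0 := by
  rw [Matrix.trace_smul, Matrix.trace_sub, Matrix.trace_conjTranspose, Matrix.trace_fin_two, su2_apply_11,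
    Complex.star_def, map_add, Complex.conj_conj, add_comm ((starRingEnd ℂ) _) ((U : Matrix (Fin 2) (Fin 2) ℂ) 0 0),
    sub_self, smul_zero]

/-- `H − 1 = ξ + θ` with `ξ = ½(H − Hᴴ)` the skew part and `θ = ½((H − 1) + (H − 1)ᴴ)` the Hermitian part. [folklore] -/
theorem sub_one_eq_skewPart_add (H : Matrix (Fin 2) (Fin 2) ℂ) :
    H - 1 = (2 : ℝ)⁻¹ • (H - Hᴴ) + (2 : ℝ)⁻¹ • ((H - 1) + (H - 1)ᴴ) := by
  rw [← smul_add, Matrix.conjTranspose_sub, Matrix.conjTranspose_one]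
  have e : H - Hᴴ + (H - 1 + (Hᴴ - 1)) = (2 : ℝ) • (H - 1) := by
    rw [two_smul]; abel
  rw [e, smul_smul, inv_mul_cancel₀ (by norm_num : (2 : ℝ) ≠ 0), one_smul]

/-- `(H − 1)ᴴ = −ξ + θ` (same `ξ`, `θ`). [folklore] -/
theorem conjTranspose_sub_one_eq (H : Matrix (Fin 2) (Fin 2) ℂ) :
    (H - 1)ᴴ = -((2 : ℝ)⁻¹ • (H - Hᴴ)) + (2 : ℝ)⁻¹ • ((H - 1) + (H - 1)ᴴ) := by
  rw [← smul_neg, ← smul_add, Matrix.conjTranspose_sub, Matrix.conjTranspose_one]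
  have e : -(H - Hᴴ) + (H - 1 + (Hᴴ - 1)) = (2 : ℝ) • (Hᴴ - 1) := by
    rw [two_smul]; abel
  rw [e, smul_smul, inv_mul_cancel₀ (by norm_num : (2 : ℝ) ≠ 0), one_smul]

/-- ★ **One link, linearised.**  For unitary `Hx, Hy, R`, any `A` with `‖A‖ ≤ m ≤ ¼`, skew parts `ξx, ξy` of `Hx − 1`, `Hy − 1` and
`εx = ‖Hx − 1‖`, `εy = ‖Hy − 1‖`: the LEFT-chart coordinate of the gauge-transformed perturbed link relative to `R`,
`W = Hx·e^{A}·R·Hyᴴ·Rᴴ`, satisfies `‖A + ξx − R ξy Rᴴ‖ ≤ ‖W − 1‖ + 2m² + (3/2)m(εx + εy) + (1 + (3/2)m)εxεy + ½εx² + ½εy²`.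
[cite: Luscher1983, §2] -/
theorem norm_linearised_link_le {Hx Hy R A : Matrix (Fin 2) (Fin 2) ℂ} (hHx : Hx ∈ Matrix.unitaryGroup (Fin 2) ℂ)
    (hHy : Hy ∈ Matrix.unitaryGroup (Fin 2) ℂ) (hR : R ∈ Matrix.unitaryGroup (Fin 2) ℂ) {m : ℝ} (hm : m ≤ 1 / 4)
    (hA : ‖A‖ ≤ m) :
    ‖A + (2 : ℝ)⁻¹ • (Hx - Hxᴴ) - R * ((2 : ℝ)⁻¹ • (Hy - Hyᴴ)) * Rᴴ‖ ≤
      ‖Hx * exp A * R * Hyᴴ * Rᴴ - 1‖ +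
        (2 * m ^ 2 + 3 / 2 * m * (‖Hx - 1‖ + ‖Hy - 1‖) + (1 + 3 / 2 * m) * (‖Hx - 1‖ * ‖Hy - 1‖) +
          (2 : ℝ)⁻¹ * ‖Hx - 1‖ ^ 2 + (2 : ℝ)⁻¹ * ‖Hy - 1‖ ^ 2) := by
  have hm0 : 0 ≤ m := (norm_nonneg A).trans hA
  have hRR : R * Rᴴ = 1 := by
    simpa only [Matrix.star_eq_conjTranspose] using Matrix.mem_unitaryGroup_iff.mp hR
  set ηx : Matrix (Fin 2) (Fin 2) ℂ := Hx - 1 with hηx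
  set ηy : Matrix (Fin 2) (Fin 2) ℂ := Hy - 1 with hηy
  set E : Matrix (Fin 2) (Fin 2) ℂ := exp A - 1 with hE
  set K : Matrix (Fin 2) (Fin 2) ℂ := R * ηyᴴ * Rᴴ with hK
  set ξx : Matrix (Fin 2) (Fin 2) ℂ := (2 : ℝ)⁻¹ • (Hx - Hxᴴ) with hξx
  set ξy : Matrix (Fin 2) (Fin 2) ℂ := (2 : ℝ)⁻¹ • (Hy - Hyᴴ) with hξy
  set θx : Matrix (Fin 2) (Fin 2) ℂ := (2 : ℝ)⁻¹ • (ηx + ηxᴴ) with hθx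
  set θy : Matrix (Fin 2) (Fin 2) ℂ := (2 : ℝ)⁻¹ • (ηy + ηyᴴ) with hθy
  set W : Matrix (Fin 2) (Fin 2) ℂ := Hx * exp A * R * Hyᴴ * Rᴴ with hW
  -- the product structure `W = (1 + ηx)(1 + E)(1 + K)`
  have hW1 : W - 1 = ηx + E + K + (ηx * E + ηx * K + E * K + ηx * E * K) := by
    have e1 : Hx = 1 + ηx := by rw [hηx]; abel
    have e2 : exp A = 1 + E := by rw [hE]; abel
    have e3 : R * Hyᴴ * Rᴴ = 1 + K := by
      have : Hyᴴ = 1 + ηyᴴ := by rw [hηy, Matrix.conjTranspose_sub, Matrix.conjTranspose_one]; abel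
      rw [this, hK, Matrix.mul_add, Matrix.mul_one, Matrix.add_mul, hRR]
    have e4 : W = Hx * exp A * (R * Hyᴴ * Rᴴ) := by rw [hW]; simp only [Matrix.mul_assoc]
    rw [e4, e3, e1, e2]; noncomm_ring
  -- skew / Hermitian decomposition of `ηx` and `ηyᴴ`
  have hηx_dec : ηx = ξx + θx := sub_one_eq_skewPart_add Hx
  have hηy_dec : ηyᴴ = -ξy + θy := conjTranspose_sub_one_eq Hy
  have hK_dec : K = -(R * ξy * Rᴴ) + R * θy * Rᴴ := by
    rw [hK, hηy_dec, Matrix.mul_add, Matrix.add_mul, Matrix.mul_neg, Matrix.neg_mul]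
  -- the identity for the linearised coordinate
  have hlin : A + ξx - R * ξy * Rᴴ = (W - 1) - (E - A) - (ηx * E + ηx * K + E * K + ηx * E * K) - θx - R * θy * Rᴴ := by
    rw [hW1, hηx_dec, hK_dec]; abel
  -- sizes
  have hE_A : ‖E - A‖ ≤ 2 * m ^ 2 := by
    have h := norm_exp_sub_one_sub_le (X := A) (hA.trans (hm.trans (by norm_num)))
    rw [hE]
    calc ‖exp A - 1 - A‖ ≤ 2 * ‖A‖ ^ 2 := h
      _ ≤ 2 * m ^ 2 := by gcongr
  have hEn : ‖E‖ ≤ 3 / 2 * m := (norm_exp_sub_one_le' (hA.trans hm)).trans (by linarith)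
  have hKn : ‖K‖ = ‖ηy‖ := by
    rw [hK, frobenius_norm_unitary_conj hR, Matrix.frobenius_norm_conjTranspose]
  have hθxn : ‖θx‖ ≤ (2 : ℝ)⁻¹ * ‖ηx‖ ^ 2 := by
    rw [hθx, norm_smul, Real.norm_eq_abs, abs_of_pos (by norm_num : (0 : ℝ) < 2⁻¹)]
    exact mul_le_mul_of_nonneg_left (norm_sub_one_add_conjTranspose_le hHx) (by norm_num)
  have hθyn : ‖R * θy * Rᴴ‖ ≤ (2 : ℝ)⁻¹ * ‖ηy‖ ^ 2 := by
    rw [frobenius_norm_unitary_conj hR, hθy, norm_smul, Real.norm_eq_abs, abs_of_pos (by norm_num : (0 : ℝ) < 2⁻¹)]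
    exact mul_le_mul_of_nonneg_left (norm_sub_one_add_conjTranspose_le hHy) (by norm_num)
  have hx0 : 0 ≤ ‖ηx‖ := norm_nonneg _
  have hy0 : 0 ≤ ‖ηy‖ := norm_nonneg _
  have hprod : ‖ηx * E + ηx * K + E * K + ηx * E * K‖ ≤
      ‖ηx‖ * (3 / 2 * m) + ‖ηx‖ * ‖ηy‖ + 3 / 2 * m * ‖ηy‖ + ‖ηx‖ * (3 / 2 * m) * ‖ηy‖ := by
    have h1 : ‖ηx * E‖ ≤ ‖ηx‖ * (3 / 2 * m) := (norm_mul_le _ _).trans (by gcongr)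
    have h2 : ‖ηx * K‖ ≤ ‖ηx‖ * ‖ηy‖ := (norm_mul_le _ _).trans (by rw [hKn])
    have h3 : ‖E * K‖ ≤ 3 / 2 * m * ‖ηy‖ := (norm_mul_le _ _).trans (by rw [hKn]; gcongr)
    have h4 : ‖ηx * E * K‖ ≤ ‖ηx‖ * (3 / 2 * m) * ‖ηy‖ := by
      calc ‖ηx * E * K‖ ≤ ‖ηx * E‖ * ‖K‖ := norm_mul_le _ _
        _ ≤ ‖ηx‖ * (3 / 2 * m) * ‖ηy‖ := by rw [hKn]; gcongr
    exact norm_add_le_of_le (norm_add_le_of_le (norm_add_le_of_le h1 h2) h3) h4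
  rw [hlin]
  calc ‖W - 1 - (E - A) - (ηx * E + ηx * K + E * K + ηx * E * K) - θx - R * θy * Rᴴ‖
      ≤ ‖W - 1‖ + ‖E - A‖ + ‖ηx * E + ηx * K + E * K + ηx * E * K‖ + ‖θx‖ + ‖R * θy * Rᴴ‖ := by
        refine (norm_sub_le _ _).trans (add_le_add ?_ le_rfl)
        refine (norm_sub_le _ _).trans (add_le_add ?_ le_rfl)
        refine (norm_sub_le _ _).trans (add_le_add ?_ le_rfl)
        exact norm_sub_le _ _
    _ ≤ ‖W - 1‖ + 2 * m ^ 2 + (‖ηx‖ * (3 / 2 * m) + ‖ηx‖ * ‖ηy‖ + 3 / 2 * m * ‖ηy‖ + ‖ηx‖ * (3 / 2 * m) * ‖ηy‖) +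
          (2 : ℝ)⁻¹ * ‖ηx‖ ^ 2 + (2 : ℝ)⁻¹ * ‖ηy‖ ^ 2 := by
        gcongr
    _ = _ := by rw [hηx, hηy]; ring


/-! ## §2 Real bookkeeping: a shifted `ℓ²` bound -/

/-- Cauchy–Schwarz: `Σ f ≤ √(#ι · Σ f²)`. [folklore] -/
theorem sum_le_sqrt_card_mul_sum_sq {ι : Type*} [Fintype ι] (f : ι → ℝ) :
    ∑ i, f i ≤ Real.sqrt ((Fintype.card ι : ℝ) * ∑ i, f i ^ 2) := by
  apply Real.le_sqrt_of_sq_le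
  have h := Finset.sum_mul_sq_le_sq_mul_sq (Finset.univ : Finset ι) (fun _ => (1 : ℝ)) f
  simp only [one_mul, one_pow, Finset.sum_const, Finset.card_univ, nsmul_eq_mul, mul_one] at h
  exact h

/-- ★ **Shifted `ℓ²` bound**: if `0 ≤ u_v ≤ f_v + ρ` termwise (`f_v, ρ ≥ 0`) then `√(Σ u_v²) ≤ √(Σ f_v²) + √#ι · ρ`
(Minkowski with a constant vector). [folklore] -/
theorem sqrt_sum_sq_le_of_le_add_const {ι : Type*} [Fintype ι] {u f : ι → ℝ} {ρ : ℝ} (hρ : 0 ≤ ρ)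
    (hu : ∀ i, 0 ≤ u i) (h : ∀ i, u i ≤ f i + ρ) :
    Real.sqrt (∑ i, u i ^ 2) ≤ Real.sqrt (∑ i, f i ^ 2) + Real.sqrt (Fintype.card ι : ℝ) * ρ := by
  set S : ℝ := ∑ i, f i ^ 2 with hS
  set N : ℝ := (Fintype.card ι : ℝ) with hN
  have hS0 : 0 ≤ S := Finset.sum_nonneg fun i _ => sq_nonneg (f i)
  have hN0 : 0 ≤ N := by positivity
  have hsumf : ∑ i, f i ≤ Real.sqrt (N * S) := sum_le_sqrt_card_mul_sum_sq f
  have h1 : ∑ i, u i ^ 2 ≤ ∑ i, (f i + ρ) ^ 2 :=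
    Finset.sum_le_sum fun i _ => pow_le_pow_left₀ (hu i) (h i) 2
  have h2 : ∑ i, (f i + ρ) ^ 2 = S + 2 * ρ * ∑ i, f i + N * ρ ^ 2 := by
    have e : ∀ i, (f i + ρ) ^ 2 = f i ^ 2 + 2 * ρ * f i + ρ ^ 2 := fun i => by ring
    simp only [e, Finset.sum_add_distrib, hS, hN, Finset.sum_const, Finset.card_univ, nsmul_eq_mul]
    rw [← Finset.mul_sum]
  have h3 : ∑ i, u i ^ 2 ≤ (Real.sqrt S + Real.sqrt N * ρ) ^ 2 := by
    rw [add_sq, Real.sq_sqrt hS0, mul_pow, Real.sq_sqrt hN0]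
    have : 2 * ρ * ∑ i, f i ≤ 2 * ρ * (Real.sqrt N * Real.sqrt S) := by
      rw [← Real.sqrt_mul hN0]; exact mul_le_mul_of_nonneg_left hsumf (by positivity)
    nlinarith [h1, h2, this]
  calc Real.sqrt (∑ i, u i ^ 2) ≤ Real.sqrt ((Real.sqrt S + Real.sqrt N * ρ) ^ 2) := Real.sqrt_le_sqrt h3
    _ = Real.sqrt S + Real.sqrt N * ρ := Real.sqrt_sq (by positivity)


/-! ## §3 `SU(2)` and ring bookkeeping -/

variable {L : ℕ} [NeZero L]

/-- `‖↑(centreElem b · u) − 1‖ = fd(u, centreElem b)`: multiplying by the sign `centreElem b = ±1` moves `u` next to `1`. [folklore] -/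
theorem norm_coe_centreElem_mul_sub_one (b : Bool) (u : SU2) :
    ‖((centreElem b * u : SU2) : Matrix (Fin 2) (Fin 2) ℂ) - 1‖ = fd u (centreElem b) := by
  unfold fd
  rw [frobNorm_eq_norm]
  cases b
  · rw [centreElem_false, one_mul, OneMemClass.coe_one]
  · rw [centreElem_true, coe_negOne_mul, coe_negOne]
    rw [← norm_neg]; congr 1; abel

omit [NeZero L] in
/-- A central sign in front of a gauge field does not change the gauge action on links. [folklore] -/
theorem gaugeTransform_centreElem_mul (b : Bool) (H : Site 3 L → SU2) (U : GaugeConfig 3 L SU2) :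
    gaugeTransform (fun x => centreElem b * H x) U = gaugeTransform H U := by
  funext e
  obtain ⟨x, k⟩ := e
  show centreElem b * H x * U (x, k) * (centreElem b * H (x.shift k))⁻¹ = H x * U (x, k) * (H (x.shift k))⁻¹
  have hc := centreElem_mem_center b
  have hcinv : (centreElem b)⁻¹ = centreElem b := by
    rw [inv_eq_iff_mul_eq_one, centreElem_mul_self]
  rw [mul_inv_rev, hcinv]
  calc centreElem b * H x * U (x, k) * ((H (x.shift k))⁻¹ * centreElem b)
      = centreElem b * (H x * U (x, k) * (H (x.shift k))⁻¹) * centreElem b := by simp only [mul_assoc]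
    _ = (H x * U (x, k) * (H (x.shift k))⁻¹) * (centreElem b * centreElem b) := by
        rw [centre_comm hc (H x * U (x, k) * (H (x.shift k))⁻¹), mul_assoc]
    _ = H x * U (x, k) * (H (x.shift k))⁻¹ := by rw [centreElem_mul_self, mul_one]

/-- … nor on the seam (conjugation). [folklore] -/
theorem centreElem_mul_conj (b : Bool) (H g : SU2) :
    centreElem b * H * g * (centreElem b * H)⁻¹ = H * g * H⁻¹ := by
  have hc := centreElem_mem_center b
  have hcinv : (centreElem b)⁻¹ = centreElem b := by
    rw [inv_eq_iff_mul_eq_one, centreElem_mul_self]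
  rw [mul_inv_rev, hcinv]
  calc centreElem b * H * g * (H⁻¹ * centreElem b) = centreElem b * (H * g * H⁻¹) * centreElem b := by simp only [mul_assoc]
    _ = (H * g * H⁻¹) * (centreElem b * centreElem b) := by rw [centre_comm hc (H * g * H⁻¹), mul_assoc]
    _ = H * g * H⁻¹ := by rw [centreElem_mul_self, mul_one]

/-- `fd(U, V) = ‖↑U·↑Vᴴ − 1‖` (right multiplication by the unitary `↑Vᴴ`). [folklore] -/
theorem fd_eq_norm_mul_conjTranspose_sub_one (U V : SU2) :
    fd U V = ‖(U : Matrix (Fin 2) (Fin 2) ℂ) * (V : Matrix (Fin 2) (Fin 2) ℂ)ᴴ - 1‖ := by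
  unfold fd
  rw [frobNorm_eq_norm]
  have hVV : (V : Matrix (Fin 2) (Fin 2) ℂ) * (V : Matrix (Fin 2) (Fin 2) ℂ)ᴴ = 1 := by
    simpa only [Matrix.star_eq_conjTranspose] using Matrix.mem_unitaryGroup_iff.mp (su2_mem_unitaryGroup V)
  have e : (U : Matrix (Fin 2) (Fin 2) ℂ) * (V : Matrix (Fin 2) (Fin 2) ℂ)ᴴ - 1 =
      ((U : Matrix (Fin 2) (Fin 2) ℂ) - V) * (V : Matrix (Fin 2) (Fin 2) ℂ)ᴴ := by
    rw [Matrix.sub_mul, hVV]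
  rw [e]
  exact (Matrix.frobenius_norm_mul_unitaryGroup _
    (⟨(V : Matrix (Fin 2) (Fin 2) ℂ)ᴴ, conjTranspose_mem_unitaryGroup (su2_mem_unitaryGroup V)⟩ :
      Matrix.unitaryGroup (Fin 2) ℂ)).symm

/-- `2 − Re tr(U V⁻¹) = ½ fd(U, V)²` on `SU(2)`. [folklore] -/
theorem two_sub_re_trace_eq_half_fd_sq (U V : SU2) :
    2 - ((su2Rep (U * V⁻¹)).trace).re = (2 : ℝ)⁻¹ * fd U V ^ 2 := by
  rw [ConstTube.re_trace_su2Rep_mul_inv_eq_norm, fd_sq_eq_two_mul]; ring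

/-- `6L³ − timeCoupling(U, V) = ½ Σ_e fd(U_e, V_e)²`. [folklore] -/
theorem timeCoupling_deficit_eq_half_sum_fd_sq (U V : GaugeConfig 3 L SU2) :
    6 * (L : ℝ) ^ 3 - timeCoupling su2Rep U V = ∑ e : Edge 3 L, (2 : ℝ)⁻¹ * fd (U e) (V e) ^ 2 := by
  rw [timeCoupling_deficit_eq]
  refine Finset.sum_congr rfl fun e _ => ?_
  rw [fd_sq_eq_two_mul]; ring

/-- The left chart moves each variable by at most `(3/2)m`: `fd(R_v, P_v) ≤ (3/2)m` when `↑P_v = e^{A}↑R_v`, `‖A‖ ≤ m ≤ ¼`. [folklore] -/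
theorem fd_le_of_coe_eq_exp_mul {U V : SU2} {A : Matrix (Fin 2) (Fin 2) ℂ} {m : ℝ} (hm : m ≤ 1 / 4) (hA : ‖A‖ ≤ m)
    (hV : (V : Matrix (Fin 2) (Fin 2) ℂ) = exp A * (U : Matrix (Fin 2) (Fin 2) ℂ)) : fd U V ≤ 3 / 2 * m := by
  unfold fd
  rw [frobNorm_eq_norm, hV]
  have e : (U : Matrix (Fin 2) (Fin 2) ℂ) - exp A * (U : Matrix (Fin 2) (Fin 2) ℂ) = -((exp A - 1) * (U : Matrix (Fin 2) (Fin 2) ℂ)) := by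
    noncomm_ring
  rw [e, norm_neg]
  have h1 : ‖(exp A - 1) * (U : Matrix (Fin 2) (Fin 2) ℂ)‖ = ‖exp A - 1‖ :=
    Matrix.frobenius_norm_mul_unitaryGroup _ (⟨(U : Matrix (Fin 2) (Fin 2) ℂ), su2_mem_unitaryGroup U⟩ : Matrix.unitaryGroup (Fin 2) ℂ)
  rw [h1]
  exact (norm_exp_sub_one_le' (hA.trans hm)).trans (by linarith)


/-- The size polynomial of `norm_linearised_link_le` is monotone in the two stabiliser errors. [folklore] -/
theorem linkRemainder_mono {m εx εy ε : ℝ} (hm0 : 0 ≤ m) (hx0 : 0 ≤ εx) (hy0 : 0 ≤ εy) (hx : εx ≤ ε) (hy : εy ≤ ε) :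
    2 * m ^ 2 + 3 / 2 * m * (εx + εy) + (1 + 3 / 2 * m) * (εx * εy) + (2 : ℝ)⁻¹ * εx ^ 2 + (2 : ℝ)⁻¹ * εy ^ 2 ≤
      2 * m ^ 2 + 3 / 2 * m * (ε + ε) + (1 + 3 / 2 * m) * (ε * ε) + (2 : ℝ)⁻¹ * ε ^ 2 + (2 : ℝ)⁻¹ * ε ^ 2 := by
  have hε0 : 0 ≤ ε := hx0.trans hx
  have h1 : εx * εy ≤ ε * ε := mul_le_mul hx hy hy0 hε0
  have h2 : εx ^ 2 ≤ ε ^ 2 := pow_le_pow_left₀ hx0 hx 2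
  have h3 : εy ^ 2 ≤ ε ^ 2 := pow_le_pow_left₀ hy0 hy 2
  have h4 : m * (εx + εy) ≤ m * (ε + ε) := mul_le_mul_of_nonneg_left (add_le_add hx hy) hm0
  have h5 : (1 + 3 / 2 * m) * (εx * εy) ≤ (1 + 3 / 2 * m) * (ε * ε) := mul_le_mul_of_nonneg_left h1 (by positivity)
  nlinarith

/-- Index count bound: `6L⁴ + L³ ≤ (2.7·L²)²` for `L ≥ 1`. [folklore] -/
theorem card_bound_aux {x : ℝ} (hx : 1 ≤ x) : 6 * x ^ 4 + x ^ 3 ≤ (27 / 10 * x ^ 2) ^ 2 := by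
  have h3 : 0 ≤ x ^ 3 := by positivity
  nlinarith [mul_le_mul_of_nonneg_left hx h3]

/-- The remainder arithmetic of Theorem A: with `ε = 9L((3/2)m + s)`, `s = √(2D)`,
`2.7L²·ρ(ε) ≤ 2500·L⁴·(m² + D)`. [folklore] -/
theorem remainder_bound_aux {x m s D ε : ℝ} (hx : 1 ≤ x) (hm0 : 0 ≤ m) (hm : m ≤ 1 / 4) (hs0 : 0 ≤ s)
    (hs2 : s ^ 2 = 2 * D) (hD0 : 0 ≤ D) (hε : ε = 9 * x * (3 / 2 * m + s)) :
    27 / 10 * x ^ 2 * (2 * m ^ 2 + 3 / 2 * m * (ε + ε) + (1 + 3 / 2 * m) * (ε * ε) + (2 : ℝ)⁻¹ * ε ^ 2 + (2 : ℝ)⁻¹ * ε ^ 2) ≤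
      2500 * x ^ 4 * (m ^ 2 + D) := by
  have hx0 : 0 ≤ x := by linarith
  have hε0 : 0 ≤ ε := by rw [hε]; positivity
  have hε2 : ε ^ 2 ≤ 729 / 2 * x ^ 2 * m ^ 2 + 324 * x ^ 2 * D := by
    have e : ε = 27 / 2 * x * m + 9 * x * s := by rw [hε]; ring
    rw [e]; nlinarith [sq_nonneg (27 / 2 * x * m - 9 * x * s)]
  have hms : m * s ≤ (m ^ 2 + 2 * D) / 2 := by nlinarith [sq_nonneg (m - s)]
  have hmε : m * ε ≤ 18 * x * m ^ 2 + 9 * x * D := by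
    have e : m * ε = 27 / 2 * x * m ^ 2 + 9 * x * (m * s) := by rw [hε]; ring
    rw [e]; nlinarith [mul_le_mul_of_nonneg_left hms (by positivity : (0 : ℝ) ≤ 9 * x)]
  have hρ1 : 2 * m ^ 2 + 3 / 2 * m * (ε + ε) + (1 + 3 / 2 * m) * (ε * ε) + (2 : ℝ)⁻¹ * ε ^ 2 + (2 : ℝ)⁻¹ * ε ^ 2 ≤
      2 * m ^ 2 + 3 * (m * ε) + 19 / 8 * ε ^ 2 := by
    nlinarith [mul_nonneg hm0 hε0, sq_nonneg ε]
  have hx2 : (1 : ℝ) ≤ x ^ 2 := by nlinarith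
  have hxx : x ≤ x ^ 2 := by nlinarith
  have hρ2 : 2 * m ^ 2 + 3 * (m * ε) + 19 / 8 * ε ^ 2 ≤ 922 * x ^ 2 * (m ^ 2 + D) := by
    nlinarith [hmε, hε2, mul_nonneg (sub_nonneg.mpr hxx) hm0, mul_nonneg (sub_nonneg.mpr hxx) (sq_nonneg m),
      mul_nonneg (sub_nonneg.mpr hxx) hD0, mul_nonneg (sub_nonneg.mpr hx2) (sq_nonneg m)]
  have hx4 : x ^ 2 * x ^ 2 = x ^ 4 := by ring
  calc 27 / 10 * x ^ 2 * (2 * m ^ 2 + 3 / 2 * m * (ε + ε) + (1 + 3 / 2 * m) * (ε * ε) + (2 : ℝ)⁻¹ * ε ^ 2 + (2 : ℝ)⁻¹ * ε ^ 2)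
      ≤ 27 / 10 * x ^ 2 * (922 * x ^ 2 * (m ^ 2 + D)) :=
        mul_le_mul_of_nonneg_left (hρ1.trans hρ2) (by positivity)
    _ = 27 / 10 * 922 * x ^ 4 * (m ^ 2 + D) := by ring
    _ ≤ 2500 * x ^ 4 * (m ^ 2 + D) := by
        have : 0 ≤ x ^ 4 * (m ^ 2 + D) := by positivity
        nlinarith

/-- One term of a double sum of squares is at most the double sum. [folklore] -/
theorem sq_le_double_sum_sq {α β : Type*} [Fintype α] [Fintype β] (g : α → β → ℝ) (a : α) (b : β) :
    g a b ^ 2 ≤ ∑ a', ∑ b', g a' b' ^ 2 := by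
  calc g a b ^ 2 ≤ ∑ b', g a b' ^ 2 :=
        Finset.single_le_sum (f := fun b' => g a b' ^ 2) (fun b' _ => sq_nonneg (g a b')) (Finset.mem_univ b)
    _ ≤ ∑ a', ∑ b', g a' b' ^ 2 :=
        Finset.single_le_sum (f := fun a' => ∑ b', g a' b' ^ 2)
          (fun a' _ => Finset.sum_nonneg fun b' _ => sq_nonneg (g a' b')) (Finset.mem_univ a)

/-- One term of a sum of squares is at most the sum. [folklore] -/
theorem sq_le_sum_sq {α : Type*} [Fintype α] (g : α → ℝ) (a : α) : g a ^ 2 ≤ ∑ a', g a' ^ 2 :=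
  Finset.single_le_sum (f := fun a' => g a' ^ 2) (fun a' _ => sq_nonneg (g a')) (Finset.mem_univ a)

end Summit.QuantumFields.YangMills.Theorems.VirialFluxGap.ChartPhase
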